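import Literature.Algebra.Lie.LefschetzModuleWeylOperator
import Literature.Algebra.Lie.LefschetzTripleSubdirect
import HarnessLib

/-!
# Rescaled Lefschetz pairs `(h, c·e)`, their Weyl operators `w_c = exp(c⁻¹f) exp(−c e) exp(c⁻¹f)`, and the
# "big cell" identity `exp(−c e) exp(c⁻¹ f) = exp(−c⁻¹ f) · w_c`

Topic `Literature/Algebra/Lie` (namespace `Literature.Algebra.Lie`).  Lane `lit-hodgefound` (Track 2 foundations library),
prover seat `lit-hodgefound-p08` (generation 40, row g40-#1); a theorems-only sequel of `LefschetzModule.lean` (row A1-88: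
`degreeSpace`, `IsZGrading`, `HasLefschetzProperty`, the partner `f = HasLefschetzProperty.dual`) and of
`LefschetzModuleWeylOperator.lean` (p34 g31-#1: the Weyl operator `w = exp(f) exp(−e) exp(f)`, image of `(0 1 ; −1 0) ∈ SL₂`,
`w M_m ⊆ M_{−m}`, `w (eʲ p) = (−1)^{k+j} (j!/(k−j)!) e^{k−j} p`, `w⁴ = 1`).

PURPOSE.  In `SL₂` one has, for every unit `c`,
`(1 0 ; −c 1)·(1 c⁻¹ ; 0 1) = (1 c⁻¹ ; −c 0) = (1 −c⁻¹ ; 0 1)·(0 c⁻¹ ; −c 0)` and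
`(0 c⁻¹ ; −c 0) = (1 c⁻¹ ; 0 1)(1 0 ; −c 1)(1 c⁻¹ ; 0 1)` — the product of a LOWER and an UPPER unipotent with parameters
`−c`, `c⁻¹` lies in the big Bruhat cell `B·w` with an explicit Borel factor.  Read in a Lefschetz module `(M, h, e)` with
partner `f` (André's representation `f ↦ (0 1 ; 0 0)`, `e ↦ (0 0 ; 1 0)`), this says that the operator
**`exp(−c e) ∘ exp(c⁻¹ f)` maps `⊕_{m ≥ n} M_m` onto `⊕_{m ≤ −n} M_m`** for every `n` (Theorem
`map_exp_neg_smul_mul_exp_inv_smul_dual_biSup_Ici`), because `(0 c⁻¹ ; −c 0)` is the Weyl operator `w_c` of the RESCALED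
Lefschetz pair `(h, c·e)` (partner `c⁻¹ f`), which reverses degrees, and `exp(−c⁻¹ f)` does not raise degrees.  With
`(h, e, f) = (−H, N_ℂ, N⁺)` the `𝔰𝔩₂`-triple of a limit mixed Hodge structure and `c = −2i` this is the key step of
Cattani–El Zein–Griffiths–Lê, *Hodge Theory*, Thm. 7.5.13 (1) ("the filtration `F_{√−1} := exp iN · F₀` lies in `D`" for an
`ℝ`-split polarized MHS): `exp(2iN) exp((i/2)N⁺)` carries the filtration "`p ≤ p₀`" of Deligne's bigrading to the
filtration "`q ≥ k − p₀`" (next rows of this seat).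

## Contents (all proved; `f = L.dual hgr`; `K` a field of characteristic `0`, `M` finite-dimensional)

* §1 **rescaling**: `HasLefschetzProperty.smul` (`(h, c·e)` is Lefschetz for `c ≠ 0`), `primitiveSpace_smul`
  (same primitive vectors), `dual_eq_zero_of_eq_zero` (`h = 0 ⇒ f = 0`), **`dual_smul`** (the partner of `c·e` is `c⁻¹·f`;
  Looijenga–Lunts: "`f_{ca} = c⁻¹ f_a`"), `weylOperator_smul_def` (`w_c = exp(c⁻¹f) exp(−c e) exp(c⁻¹f)`).
* §2 **the rescaled Weyl operator on strings**: `weylOperator_smul_apply_pow_primitive`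
  (`w_c (eʲ p) = (−1)^{k+j} (j!/(k−j)!) c^{k−2j} · e^{k−j} p`, written with `c⁻¹ʲ c^{k−j}`), `weylOperator_smul_mul_e`
  (`w_c e = −c⁻² f w_c`), `weylOperator_smul_mul_dual` (`w_c f = −c² e w_c`).
* §3 **degree filtrations** `⊕_{m ≤ n} M_m`, `⊕_{m ≥ n} M_m` (written as `⨆ m ∈ Set.Iic n`, `⨆ m ∈ Set.Ici n`): stability under
  operators of non-positive / non-negative degree and their exponentials (`exp_apply_mem_biSup_Iic_of_mapsTo`,
  `exp_apply_mem_biSup_Ici_of_mapsTo`), the Weyl operator exchanges them (`weylOperator_apply_mem_biSup_Iic`,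
  `weylOperator_apply_mem_biSup_Ici`).
* §4 **the big cell**: `exp_neg_smul_mul_exp_inv_smul_dual_eq` (`exp(−c e) exp(c⁻¹ f) = exp(−c⁻¹ f) w_c`), its inverse
  `exp(−c⁻¹ f) exp(c e)` (`…_mul_inv`, `…_inv_mul`), **`exp_neg_smul_mul_exp_inv_smul_dual_apply_mem`**
  (`x ∈ ⊕_{m ≥ n} M_m ⇒ exp(−c e) exp(c⁻¹ f) x ∈ ⊕_{m ≤ −n} M_m`) and the equality
  **`map_exp_neg_smul_mul_exp_inv_smul_dual_biSup_Ici`**; membership of all these operators in `K[e, f]`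
  (`exp_smul_mem_adjoin_pair_dual`, `…_mem_adjoin_pair_dual`) and the stability of `(e, f)`-stable subspaces under `K[e, f]`
  (`apply_mem_of_mem_adjoin_pair`).

THEOREMS ONLY (no definition, no named fact, no `sorry`, no instance, no notation; D-0026 net debt `0`).  As in the parent
file, Mathlib's finite exponential `IsNilpotent.exp` wants a `ℚ`-algebra; `End_K(M)` is given the `ℚ`-algebra structure through
`ℚ → K` (`Algebra.compHom`, a `letI` in statements and proofs, never an instance).  The commutator Lie ring of `End_K(M)`
(Mathlib's non-instance `LieRing.ofAssociativeRing`) is only used inside the proof of `dual_smul`, through a `letI`.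

## Sources

* Y. André, *Pour une théorie inconditionnelle des motifs*, Publ. Math. IHÉS **83** (1996), §1.2 (p. 11): the representation
  `ᶜΛ ↦ (0 1 ; 0 0)`, `L ↦ (0 0 ; 1 0)`, `h ↦ (1 0 ; 0 −1)` of `𝔰𝔩₂` and "l'élément `(0 1 ; −1 0)` de `SL₂`" (the Weyl
  operator of the parent file) [Andre1996Motifs].
* E. Looijenga, V. Lunts, *A Lie algebra attached to a projective variety*, Invent. Math. **129** (1997), §1 (1.1)
  (p. 4 of the held TeX text `paper:arxiv-alg-geom_9604014`, L31–L35: "if `a ∈ 𝔞` has the Lefschetz property, then so has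
  `ta` for `t ≠ 0` and `f_{ta} = t⁻¹ f_a`"; the tree's `isSl2Triple_smul_of_ne_zero`) [LooijengaLunts1997].
* E. Cattani, F. El Zein, P. Griffiths, Lê D. T. (eds.), *Hodge Theory*, Math. Notes **49** (2014), §7.5 Thm. 7.5.13 (1)
  (p. 308: "the filtration `F_{√−1} := exp iN · F₀` lies in `D`") and (2)–(3) before it (`ρ̂(z) = (exp zN)(exp(−iN))·F`,
  `ρ̂(z) = (exp xN)(exp(−½ log y Y))·F`) — the consumer of §4 [CattaniElZeinGriffithsLe2014].

## References

* [Andre1996Motifs] Y. André, Publ. Math. IHÉS 83 (1996) 5–49, §1.2 (p. 11).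
* [LooijengaLunts1997] E. Looijenga, V. A. Lunts, Invent. Math. 129 (1997) 361–412, §1 (1.1).
* [CattaniElZeinGriffithsLe2014] E. Cattani et al. (eds.), Hodge Theory, Math. Notes 49, Princeton (2014), §7.5 Thm. 7.5.13.
-/

noncomputable section

namespace Literature.Algebra.Lie

open Module Function Set
open scoped Nat
open HasLefschetzProperty (primitiveSpace mem_primitiveSpace_iff)

variable {K : Type*} [Field K] {M : Type*} [AddCommGroup M] [Module K M] {h e : Module.End K M}

/-! ### §0 Preliminaries on the finite exponential (coefficients in `K`) -/

section Prelim

variable [CharZero K]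

/-- The `ℚ`-algebra structure of `End_K(M)` through `ℚ → K` rescales by the rational number viewed in `K`. [folklore] -/
private theorem compHom_smul_eq' (q : ℚ) (T : Module.End K M) :
    letI := Algebra.compHom (Module.End K M) (algebraMap ℚ K)
    q • T = (q : K) • T := by
  letI := Algebra.compHom (Module.End K M) (algebraMap ℚ K)
  rw [Algebra.compHom_smul_def, eq_ratCast]

/-- The finite exponential of an operator with `aⁿ = 0`, with coefficients in `K`: `exp a = Σ_{i<n} aⁱ/i!`. [folklore] -/
private theorem exp_eq_sum_of_pow_eq_zero' {a : Module.End K M} {n : ℕ} (ha : a ^ n = 0) :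
    letI := Algebra.compHom (Module.End K M) (algebraMap ℚ K)
    IsNilpotent.exp a = ∑ i ∈ Finset.range n, ((i ! : ℕ) : K)⁻¹ • a ^ i := by
  letI := Algebra.compHom (Module.End K M) (algebraMap ℚ K)
  rw [IsNilpotent.exp_eq_sum ha]
  refine Finset.sum_congr rfl fun i _ ↦ ?_
  rw [Algebra.compHom_smul_def, map_inv₀, map_natCast]

/-- `exp a` lies in every subalgebra containing `a`. [folklore] -/
private theorem exp_mem_of_mem' {A : Subalgebra K (Module.End K M)} {a : Module.End K M} (ha : a ∈ A) :
    letI := Algebra.compHom (Module.End K M) (algebraMap ℚ K)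
    IsNilpotent.exp a ∈ A := by
  letI := Algebra.compHom (Module.End K M) (algebraMap ℚ K)
  rw [IsNilpotent.exp]
  refine Subalgebra.sum_mem _ fun i _ ↦ ?_
  rw [compHom_smul_eq']
  exact Subalgebra.smul_mem _ (Subalgebra.pow_mem _ ha _) _

/-- If `a` preserves a subspace `U`, so does `exp a` (a polynomial in `a`). [folklore] -/
private theorem exp_apply_mem_of_forall_apply_mem {U : Submodule K M} {a : Module.End K M} (haU : ∀ x ∈ U, a x ∈ U)
    (ha : IsNilpotent a) {x : M} (hx : x ∈ U) :
    letI := Algebra.compHom (Module.End K M) (algebraMap ℚ K)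
    IsNilpotent.exp a x ∈ U := by
  letI := Algebra.compHom (Module.End K M) (algebraMap ℚ K)
  obtain ⟨n, hn⟩ := ha
  have hpow : ∀ i : ℕ, (a ^ i) x ∈ U := by
    intro i
    induction i with
    | zero => simpa using hx
    | succ i ih => rw [pow_succ', Module.End.mul_apply]; exact haU _ ih
  rw [exp_eq_sum_of_pow_eq_zero' hn, LinearMap.sum_apply]
  exact Submodule.sum_mem _ fun i _ ↦ by rw [LinearMap.smul_apply]; exact U.smul_mem _ (hpow i)

end Prelim

/-! ### §1 Rescaled Lefschetz pairs `(h, c·e)` -/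

namespace HasLefschetzProperty

/-- **Rescaling a Lefschetz operator: `(h, c·e)` has the Lefschetz property for `c ≠ 0`** ("if `a ∈ 𝔞` has the Lefschetz
property, then so has `ta` for `t ≠ 0`"; `(c e)ᵏ = cᵏ eᵏ` is again a bijection `M_{−k} ⥲ M_k`).
[cite: LooijengaLunts1997, §1 (1.1) p0004 L31–L35] -/
theorem smul (L : HasLefschetzProperty h e) {c : K} (hc : c ≠ 0) : HasLefschetzProperty h (c • e) where
  mapsTo k := fun x hx ↦ by
    rw [LinearMap.smul_apply]
    exact Submodule.smul_mem _ c (L.mapsTo k hx)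
  bijOn k := by
    have hck : c ^ k ≠ 0 := pow_ne_zero k hc
    have hpow : (c • e) ^ k = c ^ k • e ^ k := smul_pow c e k
    refine ⟨fun x hx ↦ ?_, fun x hx y hy hxy ↦ ?_, fun y hy ↦ ?_⟩
    · rw [hpow, LinearMap.smul_apply]
      exact Submodule.smul_mem _ _ ((L.bijOn k).mapsTo hx)
    · rw [hpow, LinearMap.smul_apply, LinearMap.smul_apply] at hxy
      exact (L.bijOn k).injOn hx hy (smul_right_injective M hck hxy)
    · obtain ⟨x, hx, hxy⟩ := (L.bijOn k).surjOn hy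
      refine ⟨(c ^ k)⁻¹ • x, Submodule.smul_mem _ _ hx, ?_⟩
      rw [hpow, LinearMap.smul_apply, map_smul, smul_smul, mul_inv_cancel₀ hck, one_smul]
      exact hxy

/-- The primitive vectors of `(h, c·e)` are those of `(h, e)`: `ker (c e)^{k+1} = ker e^{k+1}`.
[cite: LooijengaLunts1997, §1 (1.1) p0004 L31–L35] -/
theorem primitiveSpace_smul {c : K} (hc : c ≠ 0) (k : ℕ) : primitiveSpace h (c • e) k = primitiveSpace h e k := by
  ext x
  rw [mem_primitiveSpace_iff, mem_primitiveSpace_iff, smul_pow, LinearMap.smul_apply, smul_eq_zero,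
    or_iff_right (pow_ne_zero _ hc)]

variable [CharZero K] [FiniteDimensional K M]

omit [FiniteDimensional K M] in
/-- If `h = 0` the partner vanishes: `[h, f] = −2f` forces `f = 0`. [cite: LooijengaLunts1997, §1 (1.1) p0004 L2–L4] -/
theorem dual_eq_zero_of_eq_zero (L : HasLefschetzProperty h e) (hgr : IsZGrading h) (h0 : h = 0) :
    L.dual hgr = 0 := by
  subst h0
  -- `[0, f] = 0·f − f·0` (the commutator bracket of `End_K(M)`)
  have h1 : (0 : Module.End K M) * L.dual hgr - L.dual hgr * 0 = -(2 • L.dual hgr) := L.lie_h_dual hgr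
  rw [zero_mul, mul_zero, sub_zero, eq_comm, neg_eq_zero, two_nsmul, ← two_smul K, smul_eq_zero] at h1
  exact h1.resolve_left two_ne_zero

/-- **The partner of `c·e` is `c⁻¹·f`** ("`f_{ta} = t⁻¹ f_a`": `(c e, h, c⁻¹ f)` is again an `𝔰𝔩₂`-triple, the tree's
`isSl2Triple_smul_of_ne_zero`, and the partner is unique, `eq_dual_of_isSl2Triple`).
[cite: LooijengaLunts1997, §1 (1.1) p0004 L31–L35] -/
theorem dual_smul (L : HasLefschetzProperty h e) (hgr : IsZGrading h) {c : K} (hc : c ≠ 0) :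
    (L.smul hc).dual hgr = c⁻¹ • L.dual hgr := by
  by_cases h0 : h = 0
  · rw [(L.smul hc).dual_eq_zero_of_eq_zero hgr h0, L.dual_eq_zero_of_eq_zero hgr h0, smul_zero]
  · letI : LieRing (Module.End K M) := LieRing.ofAssociativeRing
    exact ((L.smul hc).eq_dual_of_isSl2Triple hgr (isSl2Triple_smul_of_ne_zero (L.isSl2Triple_dual hgr h0) hc)).symm

/-- **The Weyl operator of the rescaled pair: `w_c = exp(c⁻¹ f) exp(−c e) exp(c⁻¹ f)`** — the image of
`(1 c⁻¹ ; 0 1)(1 0 ; −c 1)(1 c⁻¹ ; 0 1) = (0 c⁻¹ ; −c 0)`. [cite: Andre1996Motifs, §1.2 (p. 11, "l'élément (0 1 ; −1 0) de SL₂")]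
[cite: LooijengaLunts1997, §1 (1.1) p0004 L31–L35] -/
theorem weylOperator_smul_def (L : HasLefschetzProperty h e) (hgr : IsZGrading h) {c : K} (hc : c ≠ 0) :
    letI := Algebra.compHom (Module.End K M) (algebraMap ℚ K)
    (L.smul hc).weylOperator hgr =
      IsNilpotent.exp (c⁻¹ • L.dual hgr) * IsNilpotent.exp (-(c • e)) * IsNilpotent.exp (c⁻¹ • L.dual hgr) := by
  letI := Algebra.compHom (Module.End K M) (algebraMap ℚ K)
  rw [(L.smul hc).weylOperator_def hgr, L.dual_smul hgr hc]

/-! ### §2 The rescaled Weyl operator on strings; its conjugation relations in terms of `e`, `f` -/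

/-- **`w_c (eʲ p) = (−1)^{k+j} (j!/(k−j)!) · c⁻ʲ c^{k−j} · e^{k−j} p`** for `p ∈ P_{−k}`, `j ≤ k` (the parent file's string
formula for the pair `(h, c e)`, whose strings are `(c e)ʲ p = cʲ eʲ p`).
[cite: Andre1996Motifs, §1.2 (p. 11, "(0 1 ; −1 0) … s'envoie sur ± *_H")] -/
theorem weylOperator_smul_apply_pow_primitive (L : HasLefschetzProperty h e) (hgr : IsZGrading h) {c : K} (hc : c ≠ 0)
    {k : ℕ} {p : M} (hp : p ∈ primitiveSpace h e k) {j : ℕ} (hj : j ≤ k) :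
    (L.smul hc).weylOperator hgr ((e ^ j) p) =
      ((-1 : K) ^ (k + j) * ((j ! : ℕ) : K) * (((k - j) ! : ℕ) : K)⁻¹ * (c⁻¹ ^ j * c ^ (k - j))) • (e ^ (k - j)) p := by
  have hp' : p ∈ primitiveSpace h (c • e) k := by rwa [primitiveSpace_smul hc]
  have h1 := (L.smul hc).weylOperator_apply_pow_primitive hgr hp' hj
  rw [smul_pow, smul_pow, LinearMap.smul_apply, LinearMap.smul_apply, map_smul, smul_smul] at h1
  have hcj : c ^ j ≠ 0 := pow_ne_zero j hc
  have h2 := congr_arg (fun y ↦ (c ^ j)⁻¹ • y) h1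
  simp only [smul_smul, inv_mul_cancel₀ hcj, one_smul] at h2
  rw [h2]
  congr 1
  rw [inv_pow]
  ring

/-- **`w_c e = −c⁻² · f w_c`** (from `w_c (c e) = −(c⁻¹ f) w_c` for the pair `(h, c e)`): `(0 c⁻¹ ; −c 0)(0 0 ; 1 0) =
−c⁻² (0 1 ; 0 0)(0 c⁻¹ ; −c 0)`. [cite: Andre1996Motifs, §1.2 (p. 11)] -/
theorem weylOperator_smul_mul_e (L : HasLefschetzProperty h e) (hgr : IsZGrading h) {c : K} (hc : c ≠ 0) :
    (L.smul hc).weylOperator hgr * e = -((c⁻¹ ^ 2) • (L.dual hgr * (L.smul hc).weylOperator hgr)) := by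
  have h1 := (L.smul hc).weylOperator_mul_e hgr
  rw [L.dual_smul hgr hc, mul_smul_comm, smul_mul_assoc, ← smul_neg] at h1
  have h2 := congr_arg (fun y ↦ c⁻¹ • y) h1
  simp only [smul_smul, inv_mul_cancel₀ hc, one_smul] at h2
  rw [h2, smul_neg, sq]

/-- **`w_c f = −c² · e w_c`** (from `w_c (c⁻¹ f) = −(c e) w_c`). [cite: Andre1996Motifs, §1.2 (p. 11)] -/
theorem weylOperator_smul_mul_dual (L : HasLefschetzProperty h e) (hgr : IsZGrading h) {c : K} (hc : c ≠ 0) :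
    (L.smul hc).weylOperator hgr * L.dual hgr = -((c ^ 2) • (e * (L.smul hc).weylOperator hgr)) := by
  have h1 := (L.smul hc).weylOperator_mul_dual hgr
  rw [L.dual_smul hgr hc, mul_smul_comm, smul_mul_assoc, ← smul_neg] at h1
  have h2 := congr_arg (fun y ↦ c • y) h1
  simp only [smul_smul, mul_inv_cancel₀ hc, one_smul] at h2
  rw [h2, smul_neg, sq]

/-! ### §3 The degree filtrations `⊕_{m ≤ n} M_m`, `⊕_{m ≥ n} M_m` -/

omit [CharZero K] [FiniteDimensional K M] in
/-- An operator of degree `d ≤ 0` preserves `⊕_{m ≤ n} M_m`. [cite: LooijengaLunts1997, §1 (1.1) p0003 L106–L111 (graded vector spaces)] -/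
theorem apply_mem_biSup_Iic_of_mapsTo {g : Module.End K M} {d : ℤ} (hg : ∀ m : ℤ, MapsTo g (degreeSpace h m) (degreeSpace h (m + d)))
    (hd : d ≤ 0) {n : ℤ} {x : M} (hx : x ∈ ⨆ m ∈ Set.Iic n, degreeSpace h m) :
    g x ∈ ⨆ m ∈ Set.Iic n, degreeSpace h m := by
  induction hx using Submodule.iSup_induction' with
  | mem m x hx =>
    induction hx using Submodule.iSup_induction' with
    | mem hm x hx =>
      rw [Set.mem_Iic] at hm
      exact (le_iSup₂_of_le (m + d) (show m + d ∈ Set.Iic n by rw [Set.mem_Iic]; omega) le_rfl :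
        degreeSpace h (m + d) ≤ ⨆ m ∈ Set.Iic n, degreeSpace h m) (hg m hx)
    | zero => rw [map_zero]; exact Submodule.zero_mem _
    | add x y _ _ hx hy => rw [map_add]; exact Submodule.add_mem _ hx hy
  | zero => rw [map_zero]; exact Submodule.zero_mem _
  | add x y _ _ hx hy => rw [map_add]; exact Submodule.add_mem _ hx hy

omit [CharZero K] [FiniteDimensional K M] in
/-- An operator of degree `d ≥ 0` preserves `⊕_{m ≥ n} M_m`. [cite: LooijengaLunts1997, §1 (1.1) p0003 L106–L111 (graded vector spaces)] -/
theorem apply_mem_biSup_Ici_of_mapsTo {g : Module.End K M} {d : ℤ} (hg : ∀ m : ℤ, MapsTo g (degreeSpace h m) (degreeSpace h (m + d)))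
    (hd : 0 ≤ d) {n : ℤ} {x : M} (hx : x ∈ ⨆ m ∈ Set.Ici n, degreeSpace h m) :
    g x ∈ ⨆ m ∈ Set.Ici n, degreeSpace h m := by
  induction hx using Submodule.iSup_induction' with
  | mem m x hx =>
    induction hx using Submodule.iSup_induction' with
    | mem hm x hx =>
      rw [Set.mem_Ici] at hm
      exact (le_iSup₂_of_le (m + d) (show m + d ∈ Set.Ici n by rw [Set.mem_Ici]; omega) le_rfl :
        degreeSpace h (m + d) ≤ ⨆ m ∈ Set.Ici n, degreeSpace h m) (hg m hx)
    | zero => rw [map_zero]; exact Submodule.zero_mem _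
    | add x y _ _ hx hy => rw [map_add]; exact Submodule.add_mem _ hx hy
  | zero => rw [map_zero]; exact Submodule.zero_mem _
  | add x y _ _ hx hy => rw [map_add]; exact Submodule.add_mem _ hx hy

omit [FiniteDimensional K M] in
/-- **`exp(a)` preserves `⊕_{m ≤ n} M_m` for a nilpotent `a` of degree `d ≤ 0`** (e.g. `a = t·f`).
[cite: CattaniElZeinGriffithsLe2014, §7.5 Thm. 7.5.13 (3) ("ρ̂(z) = (exp xN)(exp(−½ log y Y))·F")] -/
theorem exp_apply_mem_biSup_Iic_of_mapsTo {a : Module.End K M} {d : ℤ}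
    (ha : ∀ m : ℤ, MapsTo a (degreeSpace h m) (degreeSpace h (m + d))) (hd : d ≤ 0) (han : IsNilpotent a)
    {n : ℤ} {x : M} (hx : x ∈ ⨆ m ∈ Set.Iic n, degreeSpace h m) :
    letI := Algebra.compHom (Module.End K M) (algebraMap ℚ K)
    IsNilpotent.exp a x ∈ ⨆ m ∈ Set.Iic n, degreeSpace h m :=
  exp_apply_mem_of_forall_apply_mem (fun _ hy ↦ apply_mem_biSup_Iic_of_mapsTo ha hd hy) han hx

omit [FiniteDimensional K M] in
/-- **`exp(a)` preserves `⊕_{m ≥ n} M_m` for a nilpotent `a` of degree `d ≥ 0`** (e.g. `a = s·e`).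
[cite: CattaniElZeinGriffithsLe2014, §7.5 Thm. 7.5.13 (2) ("ρ̂(z) = (exp zN)(exp(−iN))·F")] -/
theorem exp_apply_mem_biSup_Ici_of_mapsTo {a : Module.End K M} {d : ℤ}
    (ha : ∀ m : ℤ, MapsTo a (degreeSpace h m) (degreeSpace h (m + d))) (hd : 0 ≤ d) (han : IsNilpotent a)
    {n : ℤ} {x : M} (hx : x ∈ ⨆ m ∈ Set.Ici n, degreeSpace h m) :
    letI := Algebra.compHom (Module.End K M) (algebraMap ℚ K)
    IsNilpotent.exp a x ∈ ⨆ m ∈ Set.Ici n, degreeSpace h m :=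
  exp_apply_mem_of_forall_apply_mem (fun _ hy ↦ apply_mem_biSup_Ici_of_mapsTo ha hd hy) han hx

omit [FiniteDimensional K M] in
/-- `t·f` has degree `−2`. [cite: LooijengaLunts1997, §1 (1.1) p0004 L3] -/
theorem mapsTo_smul_dual (L : HasLefschetzProperty h e) (hgr : IsZGrading h) (t : K) (m : ℤ) :
    MapsTo (t • L.dual hgr) (degreeSpace h m) (degreeSpace h (m + -2)) := fun x hx ↦ by
  rw [LinearMap.smul_apply, ← sub_eq_add_neg]
  exact Submodule.smul_mem _ t (L.dual_apply_mem hgr hx)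

omit [CharZero K] [FiniteDimensional K M] in
/-- `s·e` has degree `2`. [cite: LooijengaLunts1997, §1 (1.1) p0004 L1–L2] -/
theorem mapsTo_smul_e (L : HasLefschetzProperty h e) (s : K) (m : ℤ) :
    MapsTo (s • e) (degreeSpace h m) (degreeSpace h (m + 2)) := fun x hx ↦ by
  rw [LinearMap.smul_apply]
  exact Submodule.smul_mem _ s (L.mapsTo m hx)

/-- `t·f` is nilpotent. [cite: LooijengaLunts1997, §1 (1.1) p0004 L58–L60 (finite depth)] -/
theorem isNilpotent_smul_dual (L : HasLefschetzProperty h e) (hgr : IsZGrading h) (t : K) : IsNilpotent (t • L.dual hgr) :=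
  ⟨Module.finrank K M, pow_finrank_eq_zero_of_neg hgr fun m x hx ↦ by
    rw [LinearMap.smul_apply]; exact Submodule.smul_mem _ t (L.dual_apply_mem hgr hx)⟩

/-- `s·e` is nilpotent. [cite: LooijengaLunts1997, §1 (1.1) p0004 L58–L60 (finite depth)] -/
theorem isNilpotent_smul_e (L : HasLefschetzProperty h e) (hgr : IsZGrading h) (s : K) : IsNilpotent (s • e) :=
  ⟨Module.finrank K M, pow_finrank_eq_zero hgr (L.mapsTo_smul_e s)⟩

/-- **The Weyl operator sends `⊕_{m ≥ n} M_m` into `⊕_{m ≤ −n} M_m`** (`w M_m ⊆ M_{−m}`), for any Lefschetz pair.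
[cite: Andre1996Motifs, §1.2 (p. 11)] -/
theorem weylOperator_apply_mem_biSup_Iic (L : HasLefschetzProperty h e) (hgr : IsZGrading h) {n : ℤ} {x : M}
    (hx : x ∈ ⨆ m ∈ Set.Ici n, degreeSpace h m) : L.weylOperator hgr x ∈ ⨆ m ∈ Set.Iic (-n), degreeSpace h m := by
  induction hx using Submodule.iSup_induction' with
  | mem m x hx =>
    induction hx using Submodule.iSup_induction' with
    | mem hm x hx =>
      rw [Set.mem_Ici] at hm
      exact (le_iSup₂_of_le (-m) (show -m ∈ Set.Iic (-n) by rw [Set.mem_Iic]; omega) le_rfl :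
        degreeSpace h (-m) ≤ ⨆ m ∈ Set.Iic (-n), degreeSpace h m) (L.weylOperator_apply_mem hgr hx)
    | zero => rw [map_zero]; exact Submodule.zero_mem _
    | add x y _ _ hx hy => rw [map_add]; exact Submodule.add_mem _ hx hy
  | zero => rw [map_zero]; exact Submodule.zero_mem _
  | add x y _ _ hx hy => rw [map_add]; exact Submodule.add_mem _ hx hy

/-- **The Weyl operator sends `⊕_{m ≤ n} M_m` into `⊕_{m ≥ −n} M_m`.** [cite: Andre1996Motifs, §1.2 (p. 11)] -/
theorem weylOperator_apply_mem_biSup_Ici (L : HasLefschetzProperty h e) (hgr : IsZGrading h) {n : ℤ} {x : M}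
    (hx : x ∈ ⨆ m ∈ Set.Iic n, degreeSpace h m) : L.weylOperator hgr x ∈ ⨆ m ∈ Set.Ici (-n), degreeSpace h m := by
  induction hx using Submodule.iSup_induction' with
  | mem m x hx =>
    induction hx using Submodule.iSup_induction' with
    | mem hm x hx =>
      rw [Set.mem_Iic] at hm
      exact (le_iSup₂_of_le (-m) (show -m ∈ Set.Ici (-n) by rw [Set.mem_Ici]; omega) le_rfl :
        degreeSpace h (-m) ≤ ⨆ m ∈ Set.Ici (-n), degreeSpace h m) (L.weylOperator_apply_mem hgr hx)
    | zero => rw [map_zero]; exact Submodule.zero_mem _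
    | add x y _ _ hx hy => rw [map_add]; exact Submodule.add_mem _ hx hy
  | zero => rw [map_zero]; exact Submodule.zero_mem _
  | add x y _ _ hx hy => rw [map_add]; exact Submodule.add_mem _ hx hy

omit [CharZero K] [FiniteDimensional K M] in
/-- `M_n ⊆ ⊕_{m ≥ n} M_m`. [cite: LooijengaLunts1997, §1 (1.1) p0003 L106–L111] -/
theorem degreeSpace_le_biSup_Ici (n : ℤ) : degreeSpace h n ≤ ⨆ m ∈ Set.Ici n, degreeSpace h m :=
  le_iSup₂_of_le n (Set.mem_Ici.2 le_rfl) le_rfl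

omit [CharZero K] [FiniteDimensional K M] in
/-- `M_n ⊆ ⊕_{m ≤ n} M_m`. [cite: LooijengaLunts1997, §1 (1.1) p0003 L106–L111] -/
theorem degreeSpace_le_biSup_Iic (n : ℤ) : degreeSpace h n ≤ ⨆ m ∈ Set.Iic n, degreeSpace h m :=
  le_iSup₂_of_le n (Set.mem_Iic.2 le_rfl) le_rfl

/-! ### §4 The big cell: `exp(−c e) exp(c⁻¹ f) = exp(−c⁻¹ f) · w_c` -/

/-- **`exp(−c e) exp(c⁻¹ f) = exp(−c⁻¹ f) w_c`**: `(1 0 ; −c 1)(1 c⁻¹ ; 0 1) = (1 −c⁻¹ ; 0 1)(0 c⁻¹ ; −c 0)`.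
[cite: Andre1996Motifs, §1.2 (p. 11)] [cite: CattaniElZeinGriffithsLe2014, §7.5 Thm. 7.5.13 (1)] -/
theorem exp_neg_smul_mul_exp_inv_smul_dual_eq (L : HasLefschetzProperty h e) (hgr : IsZGrading h) {c : K} (hc : c ≠ 0) :
    letI := Algebra.compHom (Module.End K M) (algebraMap ℚ K)
    IsNilpotent.exp (-(c • e)) * IsNilpotent.exp (c⁻¹ • L.dual hgr) =
      IsNilpotent.exp (-(c⁻¹ • L.dual hgr)) * (L.smul hc).weylOperator hgr := by
  letI := Algebra.compHom (Module.End K M) (algebraMap ℚ K)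
  rw [L.weylOperator_smul_def hgr hc, ← mul_assoc, ← mul_assoc,
    IsNilpotent.exp_neg_mul_exp_self (L.isNilpotent_smul_dual hgr c⁻¹), one_mul]

/-- `exp(−c e) exp(c⁻¹ f)` is invertible with inverse `exp(−c⁻¹ f) exp(c e)` (right inverse).
[cite: CattaniElZeinGriffithsLe2014, §7.5 Thm. 7.5.13 (1)] -/
theorem exp_neg_smul_mul_exp_inv_smul_dual_mul_inv (L : HasLefschetzProperty h e) (hgr : IsZGrading h) (c : K) :
    letI := Algebra.compHom (Module.End K M) (algebraMap ℚ K)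
    (IsNilpotent.exp (-(c • e)) * IsNilpotent.exp (c⁻¹ • L.dual hgr)) *
      (IsNilpotent.exp (-(c⁻¹ • L.dual hgr)) * IsNilpotent.exp (c • e)) = 1 := by
  letI := Algebra.compHom (Module.End K M) (algebraMap ℚ K)
  rw [mul_assoc, ← mul_assoc (IsNilpotent.exp (c⁻¹ • L.dual hgr)),
    IsNilpotent.exp_mul_exp_neg_self (L.isNilpotent_smul_dual hgr c⁻¹), one_mul,
    IsNilpotent.exp_neg_mul_exp_self (L.isNilpotent_smul_e hgr c)]

/-- `exp(−c⁻¹ f) exp(c e)` is also a left inverse of `exp(−c e) exp(c⁻¹ f)`. [cite: CattaniElZeinGriffithsLe2014, §7.5 Thm. 7.5.13 (1)] -/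
theorem exp_neg_smul_mul_exp_inv_smul_dual_inv_mul (L : HasLefschetzProperty h e) (hgr : IsZGrading h) (c : K) :
    letI := Algebra.compHom (Module.End K M) (algebraMap ℚ K)
    (IsNilpotent.exp (-(c⁻¹ • L.dual hgr)) * IsNilpotent.exp (c • e)) *
      (IsNilpotent.exp (-(c • e)) * IsNilpotent.exp (c⁻¹ • L.dual hgr)) = 1 := by
  letI := Algebra.compHom (Module.End K M) (algebraMap ℚ K)
  rw [mul_assoc, ← mul_assoc (IsNilpotent.exp (c • e)),
    IsNilpotent.exp_mul_exp_neg_self (L.isNilpotent_smul_e hgr c), one_mul,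
    IsNilpotent.exp_neg_mul_exp_self (L.isNilpotent_smul_dual hgr c⁻¹)]

/-- **`exp(−c e) exp(c⁻¹ f)` maps `⊕_{m ≥ n} M_m` into `⊕_{m ≤ −n} M_m`** (`= exp(−c⁻¹ f) w_c`: `w_c` reverses the degrees
and `exp(−c⁻¹ f)` does not raise them).  With `(h, e, f) = (−H, N_ℂ, N⁺)` and `c = −2i`: `exp(2iN) exp((i/2)N⁺)` carries
`⊕_{p ≤ p₀} I^{p,q}` (inside each `⊕_{p−q=d} I^{p,q}`) to `⊕_{q ≥ k−p₀} I^{p,q}` — the heart of "`exp iN · F₀ ∈ D`".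
[cite: CattaniElZeinGriffithsLe2014, §7.5 Thm. 7.5.13 (1)] [cite: Andre1996Motifs, §1.2 (p. 11)] -/
theorem exp_neg_smul_mul_exp_inv_smul_dual_apply_mem (L : HasLefschetzProperty h e) (hgr : IsZGrading h) {c : K}
    (hc : c ≠ 0) {n : ℤ} {x : M} (hx : x ∈ ⨆ m ∈ Set.Ici n, degreeSpace h m) :
    letI := Algebra.compHom (Module.End K M) (algebraMap ℚ K)
    (IsNilpotent.exp (-(c • e)) * IsNilpotent.exp (c⁻¹ • L.dual hgr)) x ∈ ⨆ m ∈ Set.Iic (-n), degreeSpace h m := by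
  letI := Algebra.compHom (Module.End K M) (algebraMap ℚ K)
  rw [L.exp_neg_smul_mul_exp_inv_smul_dual_eq hgr hc, Module.End.mul_apply, ← neg_smul]
  exact exp_apply_mem_biSup_Iic_of_mapsTo (L.mapsTo_smul_dual hgr (-c⁻¹)) (show (-2 : ℤ) ≤ 0 by norm_num)
    (L.isNilpotent_smul_dual hgr _) ((L.smul hc).weylOperator_apply_mem_biSup_Iic hgr hx)

/-- `w_c³` maps `⊕_{m ≤ n} M_m` into `⊕_{m ≥ −n} M_m` (three degree reversals). [cite: Andre1996Motifs, §1.2 (p. 11)] -/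
theorem weylOperator_pow_three_apply_mem_biSup_Ici (L : HasLefschetzProperty h e) (hgr : IsZGrading h) {n : ℤ} {x : M}
    (hx : x ∈ ⨆ m ∈ Set.Iic n, degreeSpace h m) : (L.weylOperator hgr ^ 3) x ∈ ⨆ m ∈ Set.Ici (-n), degreeSpace h m := by
  rw [show (3 : ℕ) = 1 + 1 + 1 from rfl, pow_succ, pow_succ, pow_one, Module.End.mul_apply, Module.End.mul_apply]
  have h1 := L.weylOperator_apply_mem_biSup_Ici hgr hx
  have h2 := L.weylOperator_apply_mem_biSup_Iic hgr h1
  rw [neg_neg] at h2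
  exact L.weylOperator_apply_mem_biSup_Ici hgr h2

/-- **`exp(−c e) exp(c⁻¹ f)` maps `⊕_{m ≥ n} M_m` ONTO `⊕_{m ≤ −n} M_m`**: the preimage of `y` is
`w_c³ exp(c⁻¹ f) y` (`w_c⁴ = 1`). [cite: CattaniElZeinGriffithsLe2014, §7.5 Thm. 7.5.13 (1)] [cite: Andre1996Motifs, §1.2 (p. 11)] -/
theorem map_exp_neg_smul_mul_exp_inv_smul_dual_biSup_Ici (L : HasLefschetzProperty h e) (hgr : IsZGrading h) {c : K}
    (hc : c ≠ 0) (n : ℤ) :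
    letI := Algebra.compHom (Module.End K M) (algebraMap ℚ K)
    (⨆ m ∈ Set.Ici n, degreeSpace h m).map (IsNilpotent.exp (-(c • e)) * IsNilpotent.exp (c⁻¹ • L.dual hgr)) =
      ⨆ m ∈ Set.Iic (-n), degreeSpace h m := by
  letI := Algebra.compHom (Module.End K M) (algebraMap ℚ K)
  refine le_antisymm ?_ fun y hy ↦ ?_
  · rintro _ ⟨x, hx, rfl⟩
    exact L.exp_neg_smul_mul_exp_inv_smul_dual_apply_mem hgr hc hx
  · -- the preimage `x = w_c³ exp(c⁻¹ f) y`
    set w := (L.smul hc).weylOperator hgr with hw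
    have hfy : IsNilpotent.exp (c⁻¹ • L.dual hgr) y ∈ ⨆ m ∈ Set.Iic (-n), degreeSpace h m :=
      exp_apply_mem_biSup_Iic_of_mapsTo (L.mapsTo_smul_dual hgr c⁻¹) (show (-2 : ℤ) ≤ 0 by norm_num)
        (L.isNilpotent_smul_dual hgr _) hy
    refine ⟨(w ^ 3) (IsNilpotent.exp (c⁻¹ • L.dual hgr) y), ?_, ?_⟩
    · have h1 := (L.smul hc).weylOperator_pow_three_apply_mem_biSup_Ici hgr hfy
      rwa [neg_neg] at h1
    · rw [L.exp_neg_smul_mul_exp_inv_smul_dual_eq hgr hc, Module.End.mul_apply, ← hw, ← Module.End.mul_apply w,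
        ← pow_succ', show 3 + 1 = 4 from rfl, hw, (L.smul hc).weylOperator_pow_four hgr, Module.End.one_apply,
        ← Module.End.mul_apply, IsNilpotent.exp_neg_mul_exp_self (L.isNilpotent_smul_dual hgr c⁻¹), Module.End.one_apply]

/-! ### §5 All these operators lie in `K[e, f]`; `(e, f)`-stable subspaces -/

omit [FiniteDimensional K M] in
/-- `exp(s e)`, `exp(t f)` lie in `K[e, f]`. [cite: Andre1996Motifs, Prop. 1.2 (p. 11)] -/
theorem exp_smul_mem_adjoin_pair_dual (L : HasLefschetzProperty h e) (hgr : IsZGrading h) (s : K) :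
    letI := Algebra.compHom (Module.End K M) (algebraMap ℚ K)
    IsNilpotent.exp (s • e) ∈ Algebra.adjoin K ({e, L.dual hgr} : Set (Module.End K M)) ∧
      IsNilpotent.exp (s • L.dual hgr) ∈ Algebra.adjoin K ({e, L.dual hgr} : Set (Module.End K M)) := by
  have he : e ∈ Algebra.adjoin K ({e, L.dual hgr} : Set (Module.End K M)) := Algebra.subset_adjoin (Set.mem_insert _ _)
  have hf : L.dual hgr ∈ Algebra.adjoin K ({e, L.dual hgr} : Set (Module.End K M)) :=
    Algebra.subset_adjoin (Set.mem_insert_of_mem _ rfl)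
  exact ⟨exp_mem_of_mem' (Subalgebra.smul_mem _ he s), exp_mem_of_mem' (Subalgebra.smul_mem _ hf s)⟩

omit [FiniteDimensional K M] in
/-- `exp(−c e) exp(c⁻¹ f) ∈ K[e, f]` and `exp(−c⁻¹ f) exp(c e) ∈ K[e, f]`. [cite: Andre1996Motifs, Prop. 1.2 (p. 11)] -/
theorem exp_neg_smul_mul_exp_inv_smul_dual_mem_adjoin_pair_dual (L : HasLefschetzProperty h e) (hgr : IsZGrading h)
    (c : K) :
    letI := Algebra.compHom (Module.End K M) (algebraMap ℚ K)
    IsNilpotent.exp (-(c • e)) * IsNilpotent.exp (c⁻¹ • L.dual hgr) ∈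
        Algebra.adjoin K ({e, L.dual hgr} : Set (Module.End K M)) ∧
      IsNilpotent.exp (-(c⁻¹ • L.dual hgr)) * IsNilpotent.exp (c • e) ∈
        Algebra.adjoin K ({e, L.dual hgr} : Set (Module.End K M)) := by
  letI := Algebra.compHom (Module.End K M) (algebraMap ℚ K)
  have h1 := L.exp_smul_mem_adjoin_pair_dual hgr (-c)
  have h2 := L.exp_smul_mem_adjoin_pair_dual hgr c⁻¹
  have h3 := L.exp_smul_mem_adjoin_pair_dual hgr (-c⁻¹)
  have h4 := L.exp_smul_mem_adjoin_pair_dual hgr c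
  simp only [neg_smul] at h1 h3
  exact ⟨Subalgebra.mul_mem _ h1.1 h2.2, Subalgebra.mul_mem _ h3.2 h4.1⟩

omit [CharZero K] [FiniteDimensional K M] in
/-- **A subspace stable under `e` and `f` is stable under every element of `K[e, f]`** (in particular under the Weyl
operators, the exponentials and their products above). [cite: Andre1996Motifs, Prop. 1.2 (p. 11)] -/
theorem apply_mem_of_mem_adjoin_pair {f : Module.End K M} {U : Submodule K M} (heU : ∀ x ∈ U, e x ∈ U)
    (hfU : ∀ x ∈ U, f x ∈ U) {g : Module.End K M} (hg : g ∈ Algebra.adjoin K ({e, f} : Set (Module.End K M)))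
    {x : M} (hx : x ∈ U) : g x ∈ U := by
  induction hg using Algebra.adjoin_induction generalizing x with
  | mem g hg =>
    rcases hg with rfl | rfl
    · exact heU x hx
    · exact hfU x hx
  | algebraMap r => rw [Module.algebraMap_end_apply]; exact U.smul_mem r hx
  | add g₁ g₂ _ _ h₁ h₂ => rw [LinearMap.add_apply]; exact U.add_mem (h₁ hx) (h₂ hx)
  | mul g₁ g₂ _ _ h₁ h₂ => rw [Module.End.mul_apply]; exact h₁ (h₂ hx)

end HasLefschetzProperty

end Literature.Algebra.Lie
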